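import Summits.CriticalPhenomena.PercolationContinuityZ3.Theorems.PercNearOneGluingNoHeavyLowerTailSahiLatinMoves

/-!
# `NoHeavyLowerTail` (crux stmt-CriticalPhenomena-4575), Sahi programme (prim-master-conj gen 50): ONE-BLOCK LEMMAS for the general
# core of the peeling theorem — the ANTIPODE BOUND `2·N_X(u) − 2^d ≤ Λ_{X,X}(u)` and the LONELY-VERTEX IDENTITY
# `Σ_{u∈S} Λ_{Sᶜ,Sᶜ}(u) + Σ_{u∉S} Λ_{S,S}(u) = Σ_{u∈S} N_{Sᶜ}(u)`

Support file (`--supports stmt-CriticalPhenomena-4575`; toolkit lemmas on the Latin link calculus of `…SahiLatinKernel`, no `sorry`, standard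
axioms).  Memo `run/shared/lean/prim/prim-l12/FROM-prim-master-conj-g50-GENERAL-CORE.md` §2.  Nothing here asserts the crux, Kahn's conjecture
or (C¼).

THE MATHEMATICS.  The points of `[3]^d` with the relation "differ in every coordinate" (`y ∈ link u`) form the graph `K₃^{⊗d}`; every vertex
has degree `2^d` (`card_link`) and the edge set is partitioned into LATIN TRIANGLES `{u, y, anti u y}`.  For a vertex set `S` (a cut) write
`N_X(u) = |X ∩ link u|` and `Λ_{X,Y}(u) = #{y ∈ link u : y ∈ X, anti u y ∈ Y}`.
* `sum_N_comm`, `sum_Lam_comm` — double counting: `Σ_{u∈A} N_B(u) = Σ_{y∈B} N_A(y)` and `Σ_{u∈A} Λ_{B,C}(u) = Σ_{y∈B} Λ_{A,C}(y)`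
  (the relation is symmetric and `anti u y = anti y u`).
* `two_mul_N_sub_pow_le_Lam` — **antipode bound**: `2·N_X(u) − 2^d ≤ Λ_{X,X}(u)` (Bonferroni on the link, the case `b = c` of
  `…SahiLatinMoves.N_add_N_le_Lam_add`).  With `X =` "the other side of the cut
  from `u`" this says: (cross-degree − half-degree)⁺ ≤ #(triangles through `u` in which `u` is the LONELY vertex).
* `sum_Lam_compl_add_sum_Lam_eq` — **lonely-vertex identity**: `Σ_{u∈S} Λ_{Sᶜ,Sᶜ}(u) + Σ_{u∈Sᶜ} Λ_{S,S}(u) = Σ_{u∈S} N_{Sᶜ}(u)` (the number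
  of (vertex, triangle) incidences with the vertex lonely equals the number of cross edges of the cut).
Together: `Σ_u (2·crossdeg(u) − 2^d)⁺ ≤ #cross edges` for EVERY cut of `K₃^{⊗d}` — the one-block inequality behind the general core bound of the
peeling theorem (`…SahiLatinZeroBottomCoreGeneral`).  Also the elementary integer inequality `four_mul_sub_le_min` used there. [this work]
-/

namespace Summit.CriticalPhenomena.PercolationContinuityZ3.Theorems.SahiLatin

open Finset

variable {ι : Type*} [Fintype ι] [DecidableEq ι]

/-! ## §1  Symmetry of the link relation and of the Latin completion -/

omit [Fintype ι] [DecidableEq ι] in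
/-- `anti` is symmetric: `anti u y = anti y u`. [this work] -/
theorem anti_comm (u y : Pt ι) : anti u y = anti y u := by
  funext i; simp only [anti, add_comm]

/-- The link relation is symmetric. [this work] -/
theorem mem_link_comm {u y : Pt ι} : y ∈ link u ↔ u ∈ link y := by
  simp only [mem_link, ne_comm]

/-- `N_s(u) = |link u ∩ s|`. [this work] -/
theorem N_eq_card_inter (s : Finset (Pt ι)) (u : Pt ι) : N s u = (link u ∩ s).card := by
  rw [N, filter_mem_eq_inter]

/-- `N_s(u)` as a sum of indicators over `s`. [this work] -/
theorem N_eq_sum_boole (s : Finset (Pt ι)) (u : Pt ι) : (N s u : ℤ) = ∑ y ∈ s, if y ∈ link u then 1 else 0 := by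
  rw [N, sum_boole, Nat.cast_inj]
  congr 1
  ext y; simp only [mem_filter, and_comm]

/-- **Double counting of cross pairs**: `Σ_{u∈A} N_B(u) = Σ_{y∈B} N_A(y)`. [this work] -/
theorem sum_N_comm (A B : Finset (Pt ι)) : ∑ u ∈ A, (N B u : ℤ) = ∑ y ∈ B, (N A y : ℤ) := by
  simp_rw [N_eq_sum_boole]
  rw [sum_comm]
  refine sum_congr rfl fun y _ => sum_congr rfl fun u _ => ?_
  simp only [mem_link_comm (u := u) (y := y)]

/-- `Λ_{B,C}(u)` as a sum of indicators over `B`. [this work] -/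
theorem Lam_eq_sum_boole (B C : Finset (Pt ι)) (u : Pt ι) :
    (Lam B C u : ℤ) = ∑ y ∈ B, if y ∈ link u ∧ anti u y ∈ C then 1 else 0 := by
  rw [Lam, sum_boole, Nat.cast_inj]
  congr 1
  ext y; simp only [mem_filter]; tauto

/-- **Double counting of lonely incidences**: `Σ_{u∈A} Λ_{B,C}(u) = Σ_{y∈B} Λ_{A,C}(y)`. [this work] -/
theorem sum_Lam_comm (A B C : Finset (Pt ι)) : ∑ u ∈ A, (Lam B C u : ℤ) = ∑ y ∈ B, (Lam A C y : ℤ) := by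
  simp_rw [Lam_eq_sum_boole]
  rw [sum_comm]
  refine sum_congr rfl fun y _ => sum_congr rfl fun u _ => ?_
  simp only [mem_link_comm (u := u) (y := y), anti_comm u y]

/-! ## §2  The antipode bound -/

/-- **Antipode bound**: `2·N_X(u) − 2^d ≤ Λ_{X,X}(u)`. [this work] -/
theorem two_mul_N_sub_pow_le_Lam (X : Finset (Pt ι)) (u : Pt ι) :
    2 * (N X u : ℤ) - 2 ^ Fintype.card ι ≤ (Lam X X u : ℤ) := by
  have h : (N X u : ℤ) + N X u ≤ Lam X X u + 2 ^ Fintype.card ι := by exact_mod_cast N_add_N_le_Lam_add X X u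
  linarith

/-- The antipode bound for the positive part: `(2·N_X(u) − 2^d)⁺ ≤ Λ_{X,X}(u)`. [this work] -/
theorem posPart_two_mul_N_sub_pow_le_Lam (X : Finset (Pt ι)) (u : Pt ι) :
    max (2 * (N X u : ℤ) - 2 ^ Fintype.card ι) 0 ≤ (Lam X X u : ℤ) :=
  max_le (two_mul_N_sub_pow_le_Lam X u) (by positivity)

/-! ## §3  The lonely-vertex identity -/

/-- Splitting `N_B(u)` by where the antipode falls: `N_B(u) = Λ_{B,C}(u) + Λ_{B,Cᶜ}(u)`. [this work] -/
theorem N_eq_Lam_add_Lam_compl (B C : Finset (Pt ι)) (u : Pt ι) : N B u = Lam B C u + Lam B Cᶜ u := by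
  rw [N, Lam, Lam]
  rw [← card_filter_add_card_filter_not (p := fun y => anti u y ∈ C)]
  simp only [filter_filter, mem_compl]

/-- **Lonely-vertex identity**: `Σ_{u∈S} Λ_{Sᶜ,Sᶜ}(u) + Σ_{u∈Sᶜ} Λ_{S,S}(u) = Σ_{u∈S} N_{Sᶜ}(u)` — lonely (vertex, triangle) incidences of a cut
are equinumerous with its cross edges. [this work] -/
theorem sum_Lam_compl_add_sum_Lam_eq (S : Finset (Pt ι)) :
    ∑ u ∈ S, (Lam Sᶜ Sᶜ u : ℤ) + ∑ u ∈ Sᶜ, (Lam S S u : ℤ) = ∑ u ∈ S, (N Sᶜ u : ℤ) := by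
  have h1 : ∑ u ∈ S, (N Sᶜ u : ℤ) = ∑ u ∈ S, ((Lam Sᶜ S u : ℤ) + (Lam Sᶜ Sᶜ u : ℤ)) := by
    refine sum_congr rfl fun u _ => ?_
    rw [N_eq_Lam_add_Lam_compl Sᶜ S u]; push_cast; ring
  rw [h1, sum_add_distrib, sum_Lam_comm S Sᶜ S]
  ring

/-- **One-block inequality**: `Σ_{u∈S} (2N_{Sᶜ}(u) − 2^d)⁺ + Σ_{u∈Sᶜ} (2N_S(u) − 2^d)⁺ ≤ Σ_{u∈S} N_{Sᶜ}(u)` — for every cut of `K₃^{⊗d}`,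
the total excess of the cross-degrees over the half-degree is at most the number of cross edges. [this work] -/
theorem sum_posPart_cross_le (S : Finset (Pt ι)) :
    ∑ u ∈ S, max (2 * (N Sᶜ u : ℤ) - 2 ^ Fintype.card ι) 0 + ∑ u ∈ Sᶜ, max (2 * (N S u : ℤ) - 2 ^ Fintype.card ι) 0
      ≤ ∑ u ∈ S, (N Sᶜ u : ℤ) := by
  rw [← sum_Lam_compl_add_sum_Lam_eq]
  exact add_le_add (sum_le_sum fun u _ => posPart_two_mul_N_sub_pow_le_Lam Sᶜ u)
    (sum_le_sum fun u _ => posPart_two_mul_N_sub_pow_le_Lam S u)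

/-! ## §4  An elementary inequality -/

/-- `4xy − 2y·l₁ − 2x·l₂ ≤ min(XY, 4xy)` whenever `0 ≤ x ≤ X`, `0 ≤ y ≤ Y`, `(2x − X)⁺ ≤ l₁`, `(2y − Y)⁺ ≤ l₂`. [this work] -/
theorem four_mul_sub_le_min {x X y Y l₁ l₂ : ℤ} (hx0 : 0 ≤ x) (hxX : x ≤ X) (hy0 : 0 ≤ y) (hyY : y ≤ Y)
    (h1 : 2 * x - X ≤ l₁) (h1' : 0 ≤ l₁) (h2 : 2 * y - Y ≤ l₂) (h2' : 0 ≤ l₂) :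
    4 * x * y - 2 * y * l₁ - 2 * x * l₂ ≤ min (X * Y) (4 * x * y) := by
  refine le_min ?_ (by nlinarith [mul_nonneg hy0 h1', mul_nonneg hx0 h2'])
  rcases le_or_gt (2 * x) X with hx | hx <;> rcases le_or_gt (2 * y) Y with hy | hy
  · nlinarith [mul_le_mul hx hy (by linarith) (by linarith), mul_nonneg hy0 h1', mul_nonneg hx0 h2']
  · nlinarith [mul_nonneg hy0 h1', mul_le_mul_of_nonneg_left h2 (by linarith : (0:ℤ) ≤ 2 * x)]
  · nlinarith [mul_nonneg hx0 h2', mul_le_mul_of_nonneg_left h1 (by linarith : (0:ℤ) ≤ 2 * y)]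
  · nlinarith [mul_le_mul_of_nonneg_left h1 (by linarith : (0:ℤ) ≤ 2 * y), mul_le_mul_of_nonneg_left h2 (by linarith : (0:ℤ) ≤ 2 * x),
      mul_nonneg (by linarith : (0:ℤ) ≤ 2 * x - X) (by linarith : (0:ℤ) ≤ 2 * y - Y)]

end Summit.CriticalPhenomena.PercolationContinuityZ3.Theorems.SahiLatin
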